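import Literature.Probability.RandomPlanarGeometry.HexSAWSurfaceWallRenewalSlackFourBumpHairpin
import Literature.Probability.RandomPlanarGeometry.HexSAWSurfaceWallRenewalSlackFourDoubleDip
import HarnessLib

/-!
# Irreducible positive wall bridges at slack four: three down steps ⇒ `D D D U U U` or the bump-then-hairpin block

[cite: MadrasSlade1993, Section 4.2, Definition 4.2.1 (irreducible bridges, p. 90) and the remark before (4.2.21) (p. 94); Section 1.2,
Definition 1.2.4 (bridges, p. 11)] [cite: Kesten1963SAW, Section 4 (irreducible bridges)]
[cite: EntingJensen2009, Section 7.4.2, Fig. 7.10 (brickwork form of the honeycomb lattice)]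
[cite: BeatonBousquetMelouDeGierDuminilCopinGuttmann2014, Section 3.1 (arXiv v5 p. 8: surface visits)]

Lane module (pub-sawmu, wall-renewal line): the join of the two slack-four cars `…SlackFourBumpHairpin` (the dispatcher
`three_down_mixed_slack_four`: three down steps not in the order `D D D U U U` ⇒ the order is `D D U D U U`, or the walk is the
bump-then-hairpin block `g3b k`) and `…SlackFourDoubleDip` (`dduduu_slack_four_false`: the order `D D U D U U` never occurs at
slack four). Together: an irreducible positive wall bridge of length `6k + 4` (`k ≥ 2`) with `k` surface visits and exactly three
down steps either has its vertical steps in the order `D D D U U U` (all three dives before the first rise), or IS the single block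
`g3b k = R D R R U R^{2k−2} D L^{2k−3} D R^{2k−2} U R U R` — and conversely `g3b k` is such a bridge with a rise before a dive. So the
three-down stratum of the slack-four diagonal `c_{6k+4}^{+,irr}(k)` is the `D D D U U U` stratum plus exactly ONE block. OURS (lane
statements; the printed sources carry only the set-up: bridges / irreducible bridges after Madras–Slade and Kesten, the brick-wall
embedding after Enting–Jensen, surface visits after Beaton et al.).
-/

namespace Literature.Probability.RandomPlanarGeometry.SAW.HexBW.Wall

open Finset Filter Function
open Literature.Probability.LatticeModels Literature.Probability.Percolation SimpleGraph

variable {ω : ℕ → Site 2}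

/-- **Three down steps at slack four: `D D D U U U` or the bump-then-hairpin block.** For an irreducible positive wall bridge of
length `m = 6k + 4` (`k ≥ 2`) with `k` visits and exactly three down steps, either the down times `p₁ < p₂ < p₃` all precede the up
times `r₁ < r₂ < r₃` (order `D D D U U U`), or the walk is `g3b k`. The dispatcher `three_down_mixed_slack_four` of
`…SlackFourBumpHairpin` leaves the orders `D D U D U U` and `D U D D U U = g3b k`; `dduduu_slack_four_false` of `…SlackFourDoubleDip`
removes the first. OURS. [cite: MadrasSlade1993, §4.2, Definition 4.2.1 (p. 90) and remark before (4.2.21) (p. 94)]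
[cite: EntingJensen2009, §7.4.2, Fig. 7.10] -/
theorem three_down_slack_four {k m : ℕ} (hk : 2 ≤ k) (hm : m = 6 * k + 4) (hω : ω ∈ ipwb m) (hv : visits m ω = k)
    (hcD : #(stepsD m ω) = 3) :
    (∃ p₁ p₂ p₃ r₁ r₂ r₃, stepsD m ω = {p₁, p₂, p₃} ∧ stepsU m ω = {r₁, r₂, r₃} ∧ p₁ < p₂ ∧ p₂ < p₃ ∧ p₃ < r₁ ∧
      r₁ < r₂ ∧ r₂ < r₃) ∨ ω = g3b k := by
  classical
  have hcU : #(stepsU m ω) = 3 := by rw [card_stepsU_eq_card_stepsD hω (by omega), hcD]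
  obtain ⟨p₁, p₂, p₃, r₁, r₂, r₃, hD, hU, h12, h23, hr12, hr23, h1, h2, h3, hp1, hpodd, hR0, hP1x, hP1y, hhor, -⟩ :=
    profile_of_card_stepsD_eq_three hω hcD hcU
  -- `p₃ ≠ r₁`: one is a down time, the other an up time
  obtain ⟨hpw, -, -⟩ := mem_ipwb.1 hω
  obtain ⟨-, -, hbw, -⟩ := mem_saws_iff.1 (saws_of_mem_pwb hpw)
  obtain ⟨-, -, hpy3, -⟩ := of_mem_stepsD_coord hbw (i := p₃) (by rw [hD]; simp)
  obtain ⟨-, -, hry1, -⟩ := of_mem_stepsU_coord hbw (i := r₁) (by rw [hU]; simp)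
  have n31 : p₃ ≠ r₁ := by intro h; rw [h] at hpy3; omega
  rcases Nat.lt_or_gt_of_ne n31 with h31 | h31
  · exact Or.inl ⟨p₁, p₂, p₃, r₁, r₂, r₃, hD, hU, h12, h23, h31, hr12, hr23⟩
  · rcases three_down_mixed_slack_four hk hm hω hv hD hU h12 h23 hr12 hr23 h1 h2 h3 hp1 hpodd hR0 hP1x hP1y hhor h31 with
      ⟨ho1, ho2, ho3⟩ | ⟨-, -, -, -, -, -, -, -, hg⟩
    · exact (dduduu_slack_four_false hk hm hω hv hD hU h12 ho1 ho2 ho3 hr23).elim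
    · exact Or.inr hg

/-- **Corollary — a rise before a dive singles out the bump-then-hairpin block.** At slack four (`m = 6k + 4`, `k ≥ 2`), an
irreducible positive wall bridge with `k` visits and three down steps, some up step of which precedes some down step, is `g3b k`.
OURS. [cite: MadrasSlade1993, §4.2, Definition 4.2.1 (p. 90)] [cite: EntingJensen2009, §7.4.2, Fig. 7.10] -/
theorem eq_g3b_of_three_down_of_up_lt_down {k m : ℕ} (hk : 2 ≤ k) (hm : m = 6 * k + 4) (hω : ω ∈ ipwb m)
    (hv : visits m ω = k) (hcD : #(stepsD m ω) = 3) {r p : ℕ} (hr : r ∈ stepsU m ω) (hp : p ∈ stepsD m ω)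
    (hrp : r < p) : ω = g3b k := by
  classical
  rcases three_down_slack_four hk hm hω hv hcD with ⟨p₁, p₂, p₃, r₁, r₂, r₃, hD, hU, h12, h23, h31, hr12, hr23⟩ | h
  · rw [hD] at hp
    rw [hU] at hr
    simp only [Finset.mem_insert, Finset.mem_singleton] at hp hr
    omega
  · exact h

/-- **The three-down stratum at slack four, mixed orders = one block.** For `k ≥ 2` and `m = 6k + 4`: a walk is an irreducible
positive wall bridge of length `m` with `k` visits, three down steps and an up step before a down step if and only if it is the
bump-then-hairpin block `g3b k` (whose up step at time `4` precedes its dive at time `2k + 3`: `stepsD_g3b`, `stepsU_g3b`,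
`g3b_mem_ipwb`, `visits_g3b` of `…SlackFourBumpHairpin`). OURS. [cite: MadrasSlade1993, §4.2, Definition 4.2.1 (p. 90) and remark
before (4.2.21) (p. 94)] [cite: EntingJensen2009, §7.4.2, Fig. 7.10] -/
theorem three_down_mixed_iff_eq_g3b {k m : ℕ} (hk : 2 ≤ k) (hm : m = 6 * k + 4) :
    (ω ∈ ipwb m ∧ visits m ω = k ∧ #(stepsD m ω) = 3 ∧ ∃ r ∈ stepsU m ω, ∃ p ∈ stepsD m ω, r < p) ↔ ω = g3b k := by
  classical
  constructor
  · rintro ⟨hω, hv, hcD, r, hr, p, hp, hrp⟩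
    exact eq_g3b_of_three_down_of_up_lt_down hk hm hω hv hcD hr hp hrp
  · rintro rfl
    refine ⟨g3b_mem_ipwb hk hm, visits_g3b hk hm, ?_, 4, ?_, 2 * k + 3, ?_, by omega⟩
    · rw [stepsD_g3b hk hm, Finset.card_insert_of_notMem (by simp; omega),
        Finset.card_insert_of_notMem (by simp; omega), Finset.card_singleton]
    · rw [stepsU_g3b hk hm]; simp
    · rw [stepsD_g3b hk hm]; simp

end Literature.Probability.RandomPlanarGeometry.SAW.HexBW.Wall
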